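import Mathlib
import Summits.ValiantsHypothesis.ValiantsHypothesis.Theorems.GrenetZeonTwoDimCoefficientsDualUnipotentCutLemma

/-!
# Crux `GrenetZeon.TwoDimCoefficients` (stmt-ValiantsHypothesis-8062) / rung `DualUnipotentThreeHalves` (stmt-24318):
# per side of the one-cut lemma — EVERY INVARIANT CUT OF A PENCIL COMPUTING `per_n` HAS A FAT CONNECTING BLOCK

✓ `rank_hess0_resolvent_const_le_of_cut` / `…_of_coordCut` (`…CutLemma`) bound the Hessian rank of a resolvent trace
`R = Σ_{j<m} tr(N^j·E)` by the connecting block of any invariant cut crossed off-diagonally by `E`.  At the Mignon–Ressayre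
point `rank Hess per_n = n²` (✓ `rank_mrHess`), so if `R = per_n`:

* ★★ `sq_le_connecting_block_of_cut` — idempotent form: `(1 − D)·N·D ≡ 0`, `D·E·D = 0 = (1 − D)·E·(1 − D)` ⟹
  `n² ≤ 6·m·rank(D·N(p₀)·(1 − D)) + 4·rank coeff(D·N·(1 − D))`;
* ★★ `sq_le_connecting_block_of_coordCut` — coordinate form: `S ⊆ Fin m` with `N i j = 0` (`i ∉ S`, `j ∈ S`) and
  `E i j = 0` whenever `i ∈ S ↔ j ∈ S` ⟹ `n² ≤ 6·m·rank[N(p₀)]_{S×Sᶜ} + 4·rank coeff[N]_{S×Sᶜ}`.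

Reading: a width-`m` nilpotent-pencil presentation of `per_n` cannot have a cut whose connecting block has pointwise rank
`o(n²/m)` and `o(n²)` independent linear parts — e.g. in the layered family every level adjacent pair must satisfy
`10·m·t ≥ n²`, i.e. EVERY level has width `≥ n²/(10m)` (so `d+1 ≤ 10m²/n²` levels: with `d = n` this is `m ≳ n^{3/2}/√10`,
the 3/2 rung for layered presentations, re-derived in `hess0` currency).

HONEST FRAMING: necessary conditions in the model; closes no stub — `stub_dualUnipotent`, 24318, `stub_longMassSlowLawInv`,
`VP ≠ VNP` untouched.  No definitions, no named facts, no sorry.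
-/

noncomputable section

-- single-conjunct layout `Summits/ValiantsHypothesis/ValiantsHypothesis`: the duplicated namespace component is mandated
set_option linter.dupNamespace false

namespace Summit.ValiantsHypothesis.ValiantsHypothesis.Theorems.GrenetZeon.CutLemma

open MvPolynomial Matrix
open Literature.Computability.AlgebraicComplexity
open Summit.ValiantsHypothesis.ValiantsHypothesis.Cruxes.TwoDimCoefficients.DimTwoCases (AffMat IsAffine)

variable {m : ℕ}

/-- The Hessian of a resolvent trace equal to `per_{k+3}` has rank `(k+3)²` at the Mignon–Ressayre point. [folklore] -/
theorem rank_hess0_resolvent_eq_sq (k : ℕ) (N : AffMat (k + 3) m) (E : Matrix (Fin m) (Fin m) ℂ)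
    (hR : perPoly (Fin (k + 3)) ℂ = ∑ j ∈ Finset.range m, (N ^ j * E.map C).trace) :
    (hess0 (transl (mrPoint ℂ k) (∑ j ∈ Finset.range m, (N ^ j * E.map C).trace))).rank = (k + 3) ^ 2 := by
  rw [← hR, hess0_transl_mrPoint_perPoly, rank_smul_eq (by exact_mod_cast Nat.factorial_ne_zero k), rank_mrHess]

/-- ★★ **Every invariant cut of a pencil computing `per_n` has a fat connecting block** (idempotent form). [folklore] -/
theorem sq_le_connecting_block_of_cut (k : ℕ) (N : AffMat (k + 3) m) (hN : IsAffine N)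
    (E D : Matrix (Fin m) (Fin m) ℂ) (hnil : N ^ m = 0) (hD : D * D = D)
    (hcutc : ∀ t : Fin (k + 3) × Fin (k + 3), (1 - D) * N.map (coeff (Finsupp.single t 1)) * D = 0)
    (hcutp : (1 - D) * N.map (eval (mrPoint ℂ k)) * D = 0)
    (hE : D * E * D = 0) (hE' : (1 - D) * E * (1 - D) = 0)
    (hR : perPoly (Fin (k + 3)) ℂ = ∑ j ∈ Finset.range m, (N ^ j * E.map C).trace) :
    (k + 3) ^ 2 ≤
      6 * (m * (D * N.map (eval (mrPoint ℂ k)) * (1 - D)).rank) +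
        4 * (Matrix.of fun (lk : Fin m × Fin m) (t : Fin (k + 3) × Fin (k + 3)) =>
          coeff (Finsupp.single t 1)
            ((D.map (C : ℂ → MvPolynomial (Fin (k + 3) × Fin (k + 3)) ℂ) * N *
              (1 - D).map (C : ℂ → MvPolynomial (Fin (k + 3) × Fin (k + 3)) ℂ)) lk.1 lk.2)).rank := by
  rw [← rank_hess0_resolvent_eq_sq k N E hR]
  exact rank_hess0_resolvent_const_le_of_cut N hN E D hnil hD hcutc (mrPoint ℂ k) hcutp hE hE'

/-- ★★ **Every invariant coordinate cut of a pencil computing `per_n` has a fat connecting block.** [folklore] -/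
theorem sq_le_connecting_block_of_coordCut (k : ℕ) (N : AffMat (k + 3) m) (hN : IsAffine N)
    (E : Matrix (Fin m) (Fin m) ℂ) (hnil : N ^ m = 0) (S : Finset (Fin m))
    (hcut : ∀ i j, i ∉ S → j ∈ S → N i j = 0) (hE : ∀ i j, (i ∈ S ↔ j ∈ S) → E i j = 0)
    (hR : perPoly (Fin (k + 3)) ℂ = ∑ j ∈ Finset.range m, (N ^ j * E.map C).trace) :
    (k + 3) ^ 2 ≤
      6 * (m * (Matrix.of fun i j : Fin m => if i ∈ S ∧ j ∉ S then eval (mrPoint ℂ k) (N i j) else 0).rank) +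
        4 * (Matrix.of fun (lk : Fin m × Fin m) (t : Fin (k + 3) × Fin (k + 3)) =>
          if lk.1 ∈ S ∧ lk.2 ∉ S then coeff (Finsupp.single t 1) (N lk.1 lk.2) else 0).rank := by
  rw [← rank_hess0_resolvent_eq_sq k N E hR]
  exact rank_hess0_resolvent_const_le_of_coordCut N hN E hnil S hcut hE (mrPoint ℂ k)

end Summit.ValiantsHypothesis.ValiantsHypothesis.Theorems.GrenetZeon.CutLemma

end
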